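import Literature.MathematicalPhysics.QuantumFieldTheory.Balaban1983to89.B9Eq325QGGQDecayOfCoerciveZd
import Literature.MathematicalPhysics.QuantumFieldTheory.Balaban1983to89.B9Eq325QGGQMajorantZd
import Literature.MathematicalPhysics.QuantumFieldTheory.Balaban1983to89.B9Thm31GpDecayPlaqClosedZd

/-!
# `Balaban1983to89.B9Eq325QGGQDecayPlaqClosedZd` — [Balaban1985BackgroundPropagators] (3.25) p. 394 ∕ Thm 3.2 p. 398 ∕ Thm 3.11 p. 416: STATION 2 CLOSED PER
# MEMBER — the kernel of `(Q′G′(U₀)²Q′*)⁻¹` on the level data `L²(𝔅, ·)` of the `ℤᵈ` frame decays exponentially between the constraint points `Lʲy`, with ONE pair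
# of constants `(C″, κ″)` for the whole closed small-field class `{U₀ unitary : ‖U₀(∂p) − 1‖ ≤ β}`, `β < (α_Q∕L²)L^{−2m}` — NO displayed hypothesis beyond
# `Q′*` injective (print's «Q′ onto»)

statement-level skeleton of published theorems with citation tags; proofs where landed; nothing here is a claim about the
Yang–Mills mass gap

`[Balaban1985BackgroundPropagators]` ("B9", CMP **99** (1985) 389–434): (3.25) p. 394 (`R = I − G′Q′*(Q′G′²Q′*)⁻¹Q′G′`), Thm 3.2 p. 398 (the model inverse and
its decay), Thm 3.1 ∕ (3.42) p. 397, Thm 3.11 p. 416 (uniformity over the small-field class), [Balaban1985RegularSpaces] (1.7) p. 77 (the class).  HERE: the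
assembly of this seat's chain — decay of `G′` on the class (`B9Thm31GpDecayPlaqClosedZd`, coercivity by dag-n06-w4 g4) ⟹ almost-local majorant of `Q′G′²Q′*`
(`B9Eq325QGGQMajorantZd`) ⟹ rows ∕ columns with the small factor `κ′` (`B9Eq349KernelCompositionZd.rowsum_expMajorant_le_linear`, fibres of `(j,y) ↦ Lʲy`
have `≤ m+1` points) ⟹ the Combes–Thomas window `ϱ(κ′) < c` for `κ′` small against dag-n06-w4 g4's coercivity constant `c` of `Q′G′²Q′*`
(`B9Eq325QGGQCoerciveCompactZd`, packaged in `B9Eq325QGGQDecayOfCoerciveZd.exists_fnorm_cZd_single_le_exp_plaqClosed`).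

CITATION HEADER (lean-in-tree rule).  Cell `pub-ymgap` (YM Track A, HUMAN RULING D-0062 ∕ D-0149 width push), DAG node N06 = [B9], width seat
`pub-ymgap-dag-n06-w2` (g4), CLAIM-8.  Inputs BY NAME as listed; nothing restated; constants crude and member-dependent (through `η`, `m`, `L`, `β`), NOT print's.

WHAT IS PROVED (kernel, 0 sorry, 0 def).
* §1 `card_filter_loc_eq_le` — the localisation `(j, y) ↦ Lʲ·y` of the constraint points has fibres of size `≤ m + 1` on `𝔅` (`L ≥ 1`).
* §2 `Kd_le_of_mem` — the lattice-sum constant `K_d(μ)` of `B9Eq349KernelCompositionZd` is bounded on `μ ∈ [κ∕8, κ∕4]` by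
  `K* = 3ᵈ·d!·(16∕κ)ᵈ·e^{κ∕8}∕(1 − e^{−κ∕16})`; `exists_small_rate` — a rate `0 < κ′ ≤ κ∕4` with `κ′·G ≤ c∕2`.
* §3 ★★★ `exists_fnorm_cZd_single_le_exp_plaqClosed_uniform` — `0 < d`, `2 ≤ L`, `η ≠ 0`, `a ≥ 0`, `β < (α_Q∕L²)L^{−2m}`, `Q′*` injective on the class:
  there are `C″ > 0`, `κ″ > 0` with `|((Q′G′(U₀)²Q′*)⁻¹ δ_{(j′,y′)}w)(j,y)|_τ ≤ C″·e^{−κ″|Lʲy − L^{j′}y′|_∞}·|w|_τ` for EVERY unitary `U₀` of the class and all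
  constraint points — station 2 of the Combes–Thomas road, closed per member.

HONEST SCOPE.  Count-neutral helper; crude member-dependent constants; no estimate of [B9] with print's constants; N05 ∕ N06 NOT discharged; K1⁸
`stmt-QuantumFields-26907` NOT closed; one finite `𝕋⁴` programme at fixed `ε`, Bałaban as printed; R4 closes only the conditional finite-`𝕋⁴` rung
`BalabanLadder.UV` — nothing continuum ∕ ℝ⁴ ∕ OS ∕ mass gap ∕ Clay.  Unit `pub-ymgap-dag-n06-w2` (g4), 2026-08-28.
-/

noncomputable section

open scoped BigOperators Nat

namespace Literature.MathematicalPhysics.QuantumFieldTheory.Balaban1983to89.B9Eq325QGGQDecayPlaqClosedZd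

open B7Prop2Explicit (unitaryUnits)
open B8Eq119TwistedAxial (bgT)
open B8Ineq132 (plaqF)
open B9Eq321LandauProjectionZd (suppSub)
open B9Eq324DeltaPrimeAZd (single restrictSite GpZd)
open B9Eq325QGGQInvZd (levSupp qggq cZd QprimeStarInjective)
open B9Eq316AveragingTransposeZd (alphaQ)
open B9Eq342CombesThomasFormZd (fnorm fnorm_nonneg blockAt)
open B9Eq325QGGQDecayOfCoerciveZd (levIndex mem_levIndex_iff singleL singleL_coe)
open B9Eq325QGGQMajorantZd (fnorm_qggq_levSingle_le)
open B9Eq349KernelCompositionZd (rowsum_expMajorant_le_linear)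
open LatticeNorms (linfDist)

export B7Prop1Explicit (Site)

variable {d : ℕ} {𝔸 : Type*} [CStarAlgebra 𝔸]

/-! ## §1  Fibres of the localisation `(j, y) ↦ Lʲ·y` -/

section Fibres

/-- **THE LOCALISATION `(j,y) ↦ Lʲ·y` HAS FIBRES OF SIZE `≤ m+1` ON `𝔅`** (`L ≥ 1`: at each level `j ≤ m` at most one `y` with `Lʲy = q`).
[cite: Balaban1985BackgroundPropagators, (3.19) p.393 (bookkeeping)] -/
theorem card_filter_loc_eq_le {L : ℕ} (hL : 1 ≤ L) (m : ℕ) (Λ : ℕ → Finset (Site d)) (q : Site d) :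
    ((levIndex m Λ).filter (fun z : ℕ × Site d => (fun i => ((L : ℤ) ^ z.1) * z.2 i) = q)).card ≤ m + 1 := by
  classical
  have h := Finset.card_le_card_of_injOn (s := (levIndex m Λ).filter (fun z : ℕ × Site d => (fun i => ((L : ℤ) ^ z.1) * z.2 i) = q))
    (t := Finset.range (m + 1)) Prod.fst (fun z hz => by
      rw [Finset.mem_coe, Finset.mem_filter, mem_levIndex_iff] at hz
      exact hz.1.1) (by
      intro z hz z' hz' hzz
      rw [Finset.mem_coe, Finset.mem_filter] at hz hz'
      have hL0 : ((L : ℤ) ^ z.1) ≠ 0 := pow_ne_zero _ (by exact_mod_cast (by omega : L ≠ 0))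
      refine Prod.ext hzz (funext fun i => ?_)
      have h1 : ((L : ℤ) ^ z.1) * z.2 i = q i := congrFun hz.2 i
      have h2 : ((L : ℤ) ^ z'.1) * z'.2 i = q i := congrFun hz'.2 i
      have hj : z'.1 = z.1 := hzz.symm
      rw [hj] at h2
      exact mul_left_cancel₀ hL0 (h1.trans h2.symm))
  rwa [Finset.card_range] at h

end Fibres

/-! ## §2  The lattice-sum constant on a compact range of rates; a small conjugation rate -/

section Rates

/-- **`K_d(μ) ≤ K*` FOR `μ ∈ [κ∕8, κ∕4]`**, `K_d(μ) = 3ᵈ·d!·(2∕μ)ᵈ·e^{μ∕2}∕(1 − e^{−μ∕2})`, `K* = 3ᵈ·d!·(2∕(κ∕8))ᵈ·e^{κ∕8}∕(1 − e^{−κ∕16})` (each factor monotone).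
[cite: Balaban1985BackgroundPropagators, (3.107)–(3.108) pp.415–416 (bookkeeping)] -/
theorem Kd_le_of_mem {μ κ : ℝ} (hκ : 0 < κ) (h1 : κ / 8 ≤ μ) (h2 : μ ≤ κ / 4) :
    (3 : ℝ) ^ d * (d ! : ℝ) * (2 / μ) ^ d * Real.exp (μ / 2) / (1 - Real.exp (-(μ / 2))) ≤
      (3 : ℝ) ^ d * (d ! : ℝ) * (2 / (κ / 8)) ^ d * Real.exp (κ / 8) / (1 - Real.exp (-(κ / 16))) := by
  have hμ : 0 < μ := lt_of_lt_of_le (by positivity) h1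
  have hden : 0 < 1 - Real.exp (-(κ / 16)) := by
    have : Real.exp (-(κ / 16)) < 1 := Real.exp_lt_one_iff.mpr (by linarith)
    linarith
  refine div_le_div₀ (by positivity) ?_ hden ?_
  · refine mul_le_mul (mul_le_mul_of_nonneg_left ?_ (by positivity)) (Real.exp_le_exp.mpr (by linarith)) (Real.exp_pos _).le (by positivity)
    exact pow_le_pow_left₀ (by positivity) (div_le_div_of_nonneg_left (by norm_num) (by positivity) h1) d
  · have : Real.exp (-(μ / 2)) ≤ Real.exp (-(κ / 16)) := Real.exp_le_exp.mpr (by linarith)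
    linarith

/-- a conjugation rate `0 < κ′ ≤ κ∕4` with `κ′·G ≤ c∕2` (`c > 0`, `κ > 0`, `G ≥ 0`). [cite: Balaban1985BackgroundPropagators, (3.42) p.397 (bookkeeping)] -/
theorem exists_small_rate {c κ G : ℝ} (hc : 0 < c) (hκ : 0 < κ) (hG : 0 ≤ G) :
    ∃ κ' : ℝ, 0 < κ' ∧ κ' ≤ κ / 4 ∧ κ' * G ≤ c / 2 := by
  refine ⟨min (κ / 4) (c / (2 * G + 1)), lt_min (by positivity) (by positivity), min_le_left _ _, ?_⟩
  calc min (κ / 4) (c / (2 * G + 1)) * G ≤ c / (2 * G + 1) * G := mul_le_mul_of_nonneg_right (min_le_right _ _) hG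
    _ ≤ c / 2 := by
        rw [div_mul_eq_mul_div, div_le_div_iff₀ (by positivity) (by norm_num)]
        nlinarith

end Rates

/-! ## §3  ★★★ Station 2 closed per member -/

section Station2

variable (L : ℕ) (η : ℝ) (τ : 𝔸 →ₗ[ℂ] ℂ) [FiniteDimensional ℝ 𝔸] [Nontrivial 𝔸]
  (hτp : ∀ a : 𝔸, a ≠ 0 → 0 < (τ (star a * a)).re) (hτt : ∀ a b : 𝔸, τ (a * b) = τ (b * a)) (hτs : ∀ a : 𝔸, τ (star a) = starRingEnd ℂ (τ a))
  (m : ℕ) (a : ℕ → ℝ) (Λ : ℕ → Finset (Site d)) (s : Finset (Site d))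

include hτt hτs in
/-- ★★★ **STATION 2 OF THE COMBES–THOMAS ROAD, CLOSED PER MEMBER: EXPONENTIAL DECAY OF THE KERNEL OF `(Q′G′(U₀)²Q′*)⁻¹` OVER THE CLOSED SMALL-FIELD CLASS.**
`0 < d`, `2 ≤ L`, `η ≠ 0`, `a ≥ 0`, finite `Ω₀ = s`, faithful Hermitian tracial `τ` on a finite-dimensional nontrivial fibre, `β < (α_Q∕L²)·L^{−2m}`, and `Q′*`
injective at every unitary background (print's «Q′ onto»).  Then there are `C″ > 0`, `κ″ > 0` such that for EVERY unitary `U₀` with `‖U₀(∂p) − 1‖ ≤ β` at all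
plaquettes and all constraint points `p = (j,y)`, `p′ = (j′,y′)` of `𝔅`:  `|((Q′G′(U₀)²Q′*)⁻¹ δ_{p′}w)(p)|_τ ≤ C″·e^{−κ″|Lʲy − L^{j′}y′|_∞}·|w|_τ`.
(Decay of `G′`: `B9Thm31GpDecayPlaqClosedZd`; majorant: `B9Eq325QGGQMajorantZd`; rows: `B9Eq349KernelCompositionZd`; coercivity of `Q′G′²Q′*` and the
reduction: dag-n06-w4 g4's `B9Eq325QGGQCoerciveCompactZd` inside `B9Eq325QGGQDecayOfCoerciveZd`.)
[cite: Balaban1985BackgroundPropagators, (3.25) p.394, Thm 3.2 p.398, Thm 3.1 p.397, Thm 3.11 p.416; Balaban1985RegularSpaces, (1.7) p.77; Balaban1985Averaging, Prop. 2 p.26] -/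
theorem exists_fnorm_cZd_single_le_exp_plaqClosed_uniform (hd : 0 < d) (hL : 2 ≤ L) (hη : η ≠ 0) (ha : ∀ j, 0 ≤ a j) {β : ℝ}
    (hβ : β < alphaQ d L / (L : ℝ) ^ 2 * (((L : ℝ) ^ m)⁻¹) ^ 2)
    (hinj : ∀ U₀ : Site d → Fin d → 𝔸ˣ, (∀ x κ, U₀ x κ ∈ unitaryUnits 𝔸) → QprimeStarInjective L U₀ τ hτp m Λ s) :
    ∃ C'' : ℝ, 0 < C'' ∧ ∃ κ'' : ℝ, 0 < κ'' ∧ ∀ (U₀ : Site d → Fin d → 𝔸ˣ) (hU : ∀ x κ', U₀ x κ' ∈ unitaryUnits 𝔸),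
      (∀ (x : Site d) (μ ν : Fin d), ‖plaqF U₀ μ ν x - 1‖ ≤ β) →
        ∀ p ∈ levIndex m Λ, ∀ p' ∈ levIndex m Λ, ∀ w : 𝔸,
          fnorm τ ((cZd L U₀ η τ hτp m a Λ s hd hη hτt hτs hU ha (hinj U₀ hU) (singleL m Λ p' w) : ℕ × Site d → 𝔸) p) ≤
            C'' * Real.exp (-(κ'' * (linfDist (fun i => ((L : ℤ) ^ p.1) * p.2 i) (fun i => ((L : ℤ) ^ p'.1) * p'.2 i) : ℝ))) * fnorm τ w := by
  classical
  have hL1 : 1 ≤ L := le_trans one_le_two hL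
  -- decay of `G′` on the class (this seat's FILE E; coercivity dag-n06-w4 g4)
  obtain ⟨C, hC, κ, hκ, hdec⟩ := B9Thm31GpDecayPlaqClosedZd.exists_fnorm_GpZd_single_le_exp_plaqClosed L η τ hτp hτt hτs m a Λ s hd hL hη ha hβ
  -- coercivity of `Q′G′²Q′*` on the class + the station-2 reduction (FILE G)
  let loc : ℕ × Site d → Site d := fun q => fun i => ((L : ℤ) ^ q.1) * q.2 i
  obtain ⟨c, hc, hG⟩ := B9Eq325QGGQDecayOfCoerciveZd.exists_fnorm_cZd_single_le_exp_plaqClosed L η τ hτp hτt hτs m a Λ s hd hL hη ha hβ hinj loc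
  -- the constants
  set Kd2 : ℝ := (3 : ℝ) ^ d * (d ! : ℝ) * (2 / (κ / 2)) ^ d * Real.exp (κ / 2 / 2) / (1 - Real.exp (-(κ / 2 / 2))) with hKd2
  set N : ℝ := (((2 * L ^ m + 1) ^ d : ℕ) : ℝ) with hN
  set C₃ : ℝ := C ^ 2 * Kd2 * N ^ 2 * Real.exp (κ * (2 * (L ^ m : ℕ))) with hC₃
  set Kstar : ℝ := (3 : ℝ) ^ d * (d ! : ℝ) * (2 / (κ / 8)) ^ d * Real.exp (κ / 8) / (1 - Real.exp (-(κ / 16))) with hKstar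
  have hKd2_0 : 0 ≤ Kd2 := by
    have h := B9Eq349KernelCompositionZd.sum_exp_neg_mul_linfDist_le (d := d) (half_pos hκ) ∅ (0 : Site d)
    rw [Finset.sum_empty] at h
    exact h
  have hC₃0 : 0 ≤ C₃ := by rw [hC₃]; positivity
  have hKstar0 : 0 ≤ Kstar := by
    have hden : 0 < 1 - Real.exp (-(κ / 16)) := by
      have : Real.exp (-(κ / 16)) < 1 := Real.exp_lt_one_iff.mpr (by linarith)
      linarith
    rw [hKstar]; positivity
  set Gst : ℝ := 2 / (κ / 4) * (C₃ * (((m + 1 : ℕ) : ℝ) * Kstar)) with hGst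
  have hGst0 : 0 ≤ Gst := by rw [hGst]; positivity
  obtain ⟨κ', hκ'0, hκ'le, hκ'G⟩ := exists_small_rate hc hκ hGst0
  set ϱ : ℝ := κ' * Gst with hϱdef
  have hϱ : ϱ < c := by rw [hϱdef]; linarith
  have hcϱ : 0 < c - ϱ := by linarith
  refine ⟨1 / (c - ϱ), by positivity, κ', hκ'0, fun U₀ hU hplaq p hp p' hp' w => ?_⟩
  -- unitary averaged transporters on the class
  have hreg := B9Thm31CoercivePrimeCompactZd.reg17Univ_of_forall_plaqF_le (𝔸 := 𝔸) hL1 m hβ hplaq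
  have hT : ∀ j', j' < m → ∀ c0 x, bgT L U₀ j' c0 x ∈ unitaryUnits 𝔸 :=
    fun j' hj' c0 x => B9Thm311PosDefNearFlatZd.bgT_mem_unitaryUnits_of_reg17UnivP hd hL m hU hreg j' hj'.le c0 x
  -- the blocks of `G′(U₀)` decay
  have hGblk : ∀ x' ∈ s, ∀ (v : 𝔸) (x : Site d),
      fnorm τ (blockAt s (GpZd L U₀ η τ hτp m a Λ s hd hη hτt hτs hU ha).toLinearMap x' v x) ≤ C * Real.exp (-(κ * (linfDist x x' : ℝ))) * fnorm τ v :=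
    fun x' hx' v x => hdec U₀ hU hplaq x' hx' v x
  -- the majorant and its rows ∕ columns
  have hblock : ∀ q ∈ levIndex m Λ, ∀ q' ∈ levIndex m Λ, ∀ w : 𝔸,
      fnorm τ ((qggq L U₀ η τ hτp m a Λ s hd hη hτt hτs hU ha (singleL m Λ q' w) : ℕ × Site d → 𝔸) q) ≤
        C₃ * Real.exp (-(κ / 2 * (linfDist (loc q) (loc q') : ℝ))) * fnorm τ w := by
    rintro ⟨j, y⟩ hq ⟨j', y'⟩ hq' w
    have hj : j ≤ m := Nat.le_of_lt_succ (Finset.mem_range.mp ((mem_levIndex_iff m Λ _).1 hq).1)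
    have hj' : j' ≤ m := Nat.le_of_lt_succ (Finset.mem_range.mp ((mem_levIndex_iff m Λ _).1 hq').1)
    have key := fnorm_qggq_levSingle_le L U₀ η τ hτp m a Λ s hd hη hτt hτs hU ha hL1 hT hC.le hκ hGblk hj hj' y y' (singleL_coe m Λ hq' w)
    rw [hC₃]
    exact key
  have hmF := card_filter_loc_eq_le hL1 m Λ
  have hrow : ∀ q ∈ levIndex m Λ, ∑ q' ∈ levIndex m Λ,
      C₃ * Real.exp (-(κ / 2 * (linfDist (loc q) (loc q') : ℝ))) * (Real.exp (κ' * (linfDist (loc q) (loc q') : ℝ)) - 1) ≤ ϱ := by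
    intro q _
    have h := rowsum_expMajorant_le_linear (d := d) (levIndex m Λ) loc (mF := m + 1) hmF hκ'0.le (by linarith : κ' < κ / 2) hC₃0
      (fun q q' => C₃ * Real.exp (-(κ / 2 * (linfDist (loc q) (loc q') : ℝ)))) (fun _ _ => le_rfl) q
    refine h.trans ((mul_assoc _ _ _).le.trans ?_)
    rw [hϱdef, hGst]
    have hμ1 : κ / 8 ≤ (κ / 2 - κ') / 2 := by linarith
    have hμ2 : (κ / 2 - κ') / 2 ≤ κ / 4 := by linarith
    have hKd := Kd_le_of_mem (d := d) hκ hμ1 hμ2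
    have hKμ0 : 0 ≤ (3 : ℝ) ^ d * (d ! : ℝ) * (2 / ((κ / 2 - κ') / 2)) ^ d * Real.exp ((κ / 2 - κ') / 2 / 2) / (1 - Real.exp (-((κ / 2 - κ') / 2 / 2))) := by
      have h0 := B9Eq349KernelCompositionZd.sum_exp_neg_mul_linfDist_le (d := d) (μ := (κ / 2 - κ') / 2) (by linarith) ∅ (0 : Site d)
      rwa [Finset.sum_empty] at h0
    have hfrac : 2 / (κ / 2 - κ') ≤ 2 / (κ / 4) := div_le_div_of_nonneg_left (by norm_num) (by positivity) (by linarith)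
    refine mul_le_mul_of_nonneg_left ?_ hκ'0.le
    exact mul_le_mul hfrac (mul_le_mul_of_nonneg_left (mul_le_mul_of_nonneg_left hKd (Nat.cast_nonneg _)) hC₃0)
      (mul_nonneg hC₃0 (mul_nonneg (Nat.cast_nonneg _) hKμ0)) (by positivity)
  have hcol : ∀ q' ∈ levIndex m Λ, ∑ q ∈ levIndex m Λ,
      C₃ * Real.exp (-(κ / 2 * (linfDist (loc q) (loc q') : ℝ))) * (Real.exp (κ' * (linfDist (loc q) (loc q') : ℝ)) - 1) ≤ ϱ := by
    intro q' hq'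
    refine le_trans (le_of_eq (Finset.sum_congr rfl fun q _ => ?_)) (hrow q' hq')
    rw [LatticeNorms.linfDist_comm (loc q) (loc q')]
  have key := hG U₀ hU hplaq κ' ϱ hκ'0.le hϱ (fun q q' => C₃ * Real.exp (-(κ / 2 * (linfDist (loc q) (loc q') : ℝ))))
    (fun q q' => by positivity) hblock hrow hcol p hp p' hp' w
  refine key.trans (le_of_eq ?_)
  rw [div_eq_mul_one_div, mul_comm (Real.exp _) (1 / (c - ϱ))]

end Station2

end Literature.MathematicalPhysics.QuantumFieldTheory.Balaban1983to89.B9Eq325QGGQDecayPlaqClosedZd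

end
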